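import Summits.Parity.GeneralizedHardyLittlewood.Theorems.FordMaynardNoSieveConst0164NegWitness0164SectionMomentsOuter

/-!
# Route `FordMaynardNoSieveConst0164`, crux `NegWitness0164` (stmt-Parity-19102), line `birth`,
# stub `stub_tweakNeg0164`: enclosure layer — section moments of the unit box, inner closed forms in raw monomial form

Helper file toward the certificate stub (K. Ford, J. Maynard, *On the theory of prime producing sieves*,
arXiv:2407.14368, §8).  Closed forms of the section moments
`M_{abc}(s) = ∫_{Δ₃(s)} 𝟙[u ∈ (0,1)³] u₀^a u₁^b u₂^c` (projection measure) on the ranges `s ∈ (0,1]`, `[1,2)`, `[2,3]`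
— this file: the inner moments `N_{ab}` restated with the RAW integrand `x ^ a * (r - x) ^ b` (explicit `^ 0`, `^ 1`, as produced by `sectionMoment_peel_0164`), from raw polynomial antiderivatives; the triple closed forms are assembled in the sibling files from `sectionMoment_peel_0164`, the inner closed forms and the outer range lemmas
(`…SectionMomentsPeel`, `…SectionMomentsOuter`) and the polynomial antiderivatives proved here.  These are the
coefficients of the piecewise-polynomial upper bounds of the α-families of (II') (`cell_integral_le_unitbox_0164`);
the values agree with the exact table in this hand's census (scripts/n3_moments.json), e.g. `M_{000} = ` Irwin–Hall.

Def-free.  References: [FordMaynard2024PrimeSieves] arXiv:2407.14368, §8 (proof of Theorem 2.7 (c)); folklore calculus.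
-/

noncomputable section

open Finset MeasureTheory Set intervalIntegral
open scoped Classical
open Literature.NumberTheory.Sieve Literature.NumberTheory.Sieve.FordMaynard

namespace Summit.Parity.GeneralizedHardyLittlewood.FordMaynardNoSieveConst0164NegWitness0164

/-- Polynomial antiderivative (generated): `∫ t^0·P(s−t)` for `P = (1 : ℝ)`. [folklore] -/
theorem rawInt_0_0_0164 (s lo hi : ℝ) :
    (∫ t in lo..hi, t ^ 0 * (s - t) ^ 0) =
      (((1 : ℝ)) * hi ^ 1 / 1) -
      (((1 : ℝ)) * lo ^ 1 / 1) := by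
  have hderiv : ∀ t : ℝ, HasDerivAt (fun t : ℝ => ((1 : ℝ)) * t ^ 1 / 1)
      (t ^ 0 * (s - t) ^ 0) t := by
    intro t
    have h0 := ((hasDerivAt_pow 1 t).const_mul ((1 : ℝ))).div_const (1 : ℝ)
    refine ((h0.congr_of_eventuallyEq ?_).congr_deriv ?_)
    · exact Filter.Eventually.of_forall fun y => rfl
    · push_cast; try ring
  rw [intervalIntegral.integral_eq_sub_of_hasDerivAt (fun t _ => hderiv t)
    ((by fun_prop : Continuous fun t : ℝ => t ^ 0 * (s - t) ^ 0).intervalIntegrable _ _)]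

/-- `N_{00}(r)` (raw integrand) for `0 < r ≤ 1`. [folklore] -/
theorem innerMomentRaw_low_0_0_0164 {r : ℝ} (hr0 : 0 < r) (hr1 : r ≤ 1) :
    (∫ x in Set.Ioo 0 r, (if (0 < x ∧ x < 1) ∧ (0 < r - x ∧ r - x < 1) then x ^ 0 * (r - x) ^ 0 else 0)) =
      (1 : ℝ) * r := by
  rw [inner_window_low_0164 hr0 hr1 (fun x : ℝ => x ^ 0 * (r - x) ^ 0), rawInt_0_0_0164 r 0 r]
  ring

/-- `N_{00}(r)` (raw integrand) for `1 ≤ r ≤ 2`. [folklore] -/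
theorem innerMomentRaw_high_0_0_0164 {r : ℝ} (hr1 : 1 ≤ r) (hr2 : r ≤ 2) :
    (∫ x in Set.Ioo 0 r, (if (0 < x ∧ x < 1) ∧ (0 < r - x ∧ r - x < 1) then x ^ 0 * (r - x) ^ 0 else 0)) =
      (2 : ℝ) + (-1 : ℝ) * r := by
  rw [inner_window_high_0164 hr1 hr2 (fun x : ℝ => x ^ 0 * (r - x) ^ 0), rawInt_0_0_0164 r (r - 1) 1]
  ring

/-- Polynomial antiderivative (generated): `∫ t^0·P(s−t)` for `P = (1 : ℝ) * r`. [folklore] -/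
theorem rawInt_0_1_0164 (s lo hi : ℝ) :
    (∫ t in lo..hi, t ^ 0 * (s - t) ^ 1) =
      (((1 : ℝ) * s) * hi ^ 1 / 1 + ((-1 : ℝ)) * hi ^ 2 / 2) -
      (((1 : ℝ) * s) * lo ^ 1 / 1 + ((-1 : ℝ)) * lo ^ 2 / 2) := by
  have hderiv : ∀ t : ℝ, HasDerivAt (fun t : ℝ => ((1 : ℝ) * s) * t ^ 1 / 1 + ((-1 : ℝ)) * t ^ 2 / 2)
      (t ^ 0 * (s - t) ^ 1) t := by
    intro t
    have h0 := ((hasDerivAt_pow 1 t).const_mul ((1 : ℝ) * s)).div_const (1 : ℝ)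
    have h1 := ((hasDerivAt_pow 2 t).const_mul ((-1 : ℝ))).div_const (2 : ℝ)
    refine (((h0.add h1).congr_of_eventuallyEq ?_).congr_deriv ?_)
    · exact Filter.Eventually.of_forall fun y => by simp only [Pi.add_apply]
    · push_cast; try ring
  rw [intervalIntegral.integral_eq_sub_of_hasDerivAt (fun t _ => hderiv t)
    ((by fun_prop : Continuous fun t : ℝ => t ^ 0 * (s - t) ^ 1).intervalIntegrable _ _)]

/-- `N_{01}(r)` (raw integrand) for `0 < r ≤ 1`. [folklore] -/
theorem innerMomentRaw_low_0_1_0164 {r : ℝ} (hr0 : 0 < r) (hr1 : r ≤ 1) :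
    (∫ x in Set.Ioo 0 r, (if (0 < x ∧ x < 1) ∧ (0 < r - x ∧ r - x < 1) then x ^ 0 * (r - x) ^ 1 else 0)) =
      (1 / 2 : ℝ) * r ^ 2 := by
  rw [inner_window_low_0164 hr0 hr1 (fun x : ℝ => x ^ 0 * (r - x) ^ 1), rawInt_0_1_0164 r 0 r]
  ring

/-- `N_{01}(r)` (raw integrand) for `1 ≤ r ≤ 2`. [folklore] -/
theorem innerMomentRaw_high_0_1_0164 {r : ℝ} (hr1 : 1 ≤ r) (hr2 : r ≤ 2) :
    (∫ x in Set.Ioo 0 r, (if (0 < x ∧ x < 1) ∧ (0 < r - x ∧ r - x < 1) then x ^ 0 * (r - x) ^ 1 else 0)) =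
      (1 : ℝ) * r + (-(1 / 2) : ℝ) * r ^ 2 := by
  rw [inner_window_high_0164 hr1 hr2 (fun x : ℝ => x ^ 0 * (r - x) ^ 1), rawInt_0_1_0164 r (r - 1) 1]
  ring

/-- Polynomial antiderivative (generated): `∫ t^0·P(s−t)` for `P = (1 : ℝ) * r ^ 2`. [folklore] -/
theorem rawInt_0_2_0164 (s lo hi : ℝ) :
    (∫ t in lo..hi, t ^ 0 * (s - t) ^ 2) =
      (((1 : ℝ) * s ^ 2) * hi ^ 1 / 1 + ((-2 : ℝ) * s) * hi ^ 2 / 2 + ((1 : ℝ)) * hi ^ 3 / 3) -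
      (((1 : ℝ) * s ^ 2) * lo ^ 1 / 1 + ((-2 : ℝ) * s) * lo ^ 2 / 2 + ((1 : ℝ)) * lo ^ 3 / 3) := by
  have hderiv : ∀ t : ℝ, HasDerivAt (fun t : ℝ => ((1 : ℝ) * s ^ 2) * t ^ 1 / 1 + ((-2 : ℝ) * s) * t ^ 2 / 2 + ((1 : ℝ)) * t ^ 3 / 3)
      (t ^ 0 * (s - t) ^ 2) t := by
    intro t
    have h0 := ((hasDerivAt_pow 1 t).const_mul ((1 : ℝ) * s ^ 2)).div_const (1 : ℝ)
    have h1 := ((hasDerivAt_pow 2 t).const_mul ((-2 : ℝ) * s)).div_const (2 : ℝ)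
    have h2 := ((hasDerivAt_pow 3 t).const_mul ((1 : ℝ))).div_const (3 : ℝ)
    refine ((((h0.add h1).add h2).congr_of_eventuallyEq ?_).congr_deriv ?_)
    · exact Filter.Eventually.of_forall fun y => by simp only [Pi.add_apply]
    · push_cast; try ring
  rw [intervalIntegral.integral_eq_sub_of_hasDerivAt (fun t _ => hderiv t)
    ((by fun_prop : Continuous fun t : ℝ => t ^ 0 * (s - t) ^ 2).intervalIntegrable _ _)]

/-- `N_{02}(r)` (raw integrand) for `0 < r ≤ 1`. [folklore] -/
theorem innerMomentRaw_low_0_2_0164 {r : ℝ} (hr0 : 0 < r) (hr1 : r ≤ 1) :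
    (∫ x in Set.Ioo 0 r, (if (0 < x ∧ x < 1) ∧ (0 < r - x ∧ r - x < 1) then x ^ 0 * (r - x) ^ 2 else 0)) =
      (1 / 3 : ℝ) * r ^ 3 := by
  rw [inner_window_low_0164 hr0 hr1 (fun x : ℝ => x ^ 0 * (r - x) ^ 2), rawInt_0_2_0164 r 0 r]
  ring

/-- `N_{02}(r)` (raw integrand) for `1 ≤ r ≤ 2`. [folklore] -/
theorem innerMomentRaw_high_0_2_0164 {r : ℝ} (hr1 : 1 ≤ r) (hr2 : r ≤ 2) :
    (∫ x in Set.Ioo 0 r, (if (0 < x ∧ x < 1) ∧ (0 < r - x ∧ r - x < 1) then x ^ 0 * (r - x) ^ 2 else 0)) =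
      (2 / 3 : ℝ) + (-1 : ℝ) * r + (1 : ℝ) * r ^ 2 + (-(1 / 3) : ℝ) * r ^ 3 := by
  rw [inner_window_high_0164 hr1 hr2 (fun x : ℝ => x ^ 0 * (r - x) ^ 2), rawInt_0_2_0164 r (r - 1) 1]
  ring

/-- Polynomial antiderivative (generated): `∫ t^1·P(s−t)` for `P = (1 : ℝ)`. [folklore] -/
theorem rawInt_1_0_0164 (s lo hi : ℝ) :
    (∫ t in lo..hi, t ^ 1 * (s - t) ^ 0) =
      (((1 : ℝ)) * hi ^ 2 / 2) -
      (((1 : ℝ)) * lo ^ 2 / 2) := by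
  have hderiv : ∀ t : ℝ, HasDerivAt (fun t : ℝ => ((1 : ℝ)) * t ^ 2 / 2)
      (t ^ 1 * (s - t) ^ 0) t := by
    intro t
    have h0 := ((hasDerivAt_pow 2 t).const_mul ((1 : ℝ))).div_const (2 : ℝ)
    refine ((h0.congr_of_eventuallyEq ?_).congr_deriv ?_)
    · exact Filter.Eventually.of_forall fun y => rfl
    · push_cast; try ring
  rw [intervalIntegral.integral_eq_sub_of_hasDerivAt (fun t _ => hderiv t)
    ((by fun_prop : Continuous fun t : ℝ => t ^ 1 * (s - t) ^ 0).intervalIntegrable _ _)]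

/-- `N_{10}(r)` (raw integrand) for `0 < r ≤ 1`. [folklore] -/
theorem innerMomentRaw_low_1_0_0164 {r : ℝ} (hr0 : 0 < r) (hr1 : r ≤ 1) :
    (∫ x in Set.Ioo 0 r, (if (0 < x ∧ x < 1) ∧ (0 < r - x ∧ r - x < 1) then x ^ 1 * (r - x) ^ 0 else 0)) =
      (1 / 2 : ℝ) * r ^ 2 := by
  rw [inner_window_low_0164 hr0 hr1 (fun x : ℝ => x ^ 1 * (r - x) ^ 0), rawInt_1_0_0164 r 0 r]
  ring

/-- `N_{10}(r)` (raw integrand) for `1 ≤ r ≤ 2`. [folklore] -/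
theorem innerMomentRaw_high_1_0_0164 {r : ℝ} (hr1 : 1 ≤ r) (hr2 : r ≤ 2) :
    (∫ x in Set.Ioo 0 r, (if (0 < x ∧ x < 1) ∧ (0 < r - x ∧ r - x < 1) then x ^ 1 * (r - x) ^ 0 else 0)) =
      (1 : ℝ) * r + (-(1 / 2) : ℝ) * r ^ 2 := by
  rw [inner_window_high_0164 hr1 hr2 (fun x : ℝ => x ^ 1 * (r - x) ^ 0), rawInt_1_0_0164 r (r - 1) 1]
  ring

/-- Polynomial antiderivative (generated): `∫ t^1·P(s−t)` for `P = (1 : ℝ) * r`. [folklore] -/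
theorem rawInt_1_1_0164 (s lo hi : ℝ) :
    (∫ t in lo..hi, t ^ 1 * (s - t) ^ 1) =
      (((1 : ℝ) * s) * hi ^ 2 / 2 + ((-1 : ℝ)) * hi ^ 3 / 3) -
      (((1 : ℝ) * s) * lo ^ 2 / 2 + ((-1 : ℝ)) * lo ^ 3 / 3) := by
  have hderiv : ∀ t : ℝ, HasDerivAt (fun t : ℝ => ((1 : ℝ) * s) * t ^ 2 / 2 + ((-1 : ℝ)) * t ^ 3 / 3)
      (t ^ 1 * (s - t) ^ 1) t := by
    intro t
    have h0 := ((hasDerivAt_pow 2 t).const_mul ((1 : ℝ) * s)).div_const (2 : ℝ)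
    have h1 := ((hasDerivAt_pow 3 t).const_mul ((-1 : ℝ))).div_const (3 : ℝ)
    refine (((h0.add h1).congr_of_eventuallyEq ?_).congr_deriv ?_)
    · exact Filter.Eventually.of_forall fun y => by simp only [Pi.add_apply]
    · push_cast; try ring
  rw [intervalIntegral.integral_eq_sub_of_hasDerivAt (fun t _ => hderiv t)
    ((by fun_prop : Continuous fun t : ℝ => t ^ 1 * (s - t) ^ 1).intervalIntegrable _ _)]

/-- `N_{11}(r)` (raw integrand) for `0 < r ≤ 1`. [folklore] -/
theorem innerMomentRaw_low_1_1_0164 {r : ℝ} (hr0 : 0 < r) (hr1 : r ≤ 1) :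
    (∫ x in Set.Ioo 0 r, (if (0 < x ∧ x < 1) ∧ (0 < r - x ∧ r - x < 1) then x ^ 1 * (r - x) ^ 1 else 0)) =
      (1 / 6 : ℝ) * r ^ 3 := by
  rw [inner_window_low_0164 hr0 hr1 (fun x : ℝ => x ^ 1 * (r - x) ^ 1), rawInt_1_1_0164 r 0 r]
  ring

/-- `N_{11}(r)` (raw integrand) for `1 ≤ r ≤ 2`. [folklore] -/
theorem innerMomentRaw_high_1_1_0164 {r : ℝ} (hr1 : 1 ≤ r) (hr2 : r ≤ 2) :
    (∫ x in Set.Ioo 0 r, (if (0 < x ∧ x < 1) ∧ (0 < r - x ∧ r - x < 1) then x ^ 1 * (r - x) ^ 1 else 0)) =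
      (-(2 / 3) : ℝ) + (1 : ℝ) * r + (-(1 / 6) : ℝ) * r ^ 3 := by
  rw [inner_window_high_0164 hr1 hr2 (fun x : ℝ => x ^ 1 * (r - x) ^ 1), rawInt_1_1_0164 r (r - 1) 1]
  ring

/-- Polynomial antiderivative (generated): `∫ t^1·P(s−t)` for `P = (1 : ℝ) * r ^ 2`. [folklore] -/
theorem rawInt_1_2_0164 (s lo hi : ℝ) :
    (∫ t in lo..hi, t ^ 1 * (s - t) ^ 2) =
      (((1 : ℝ) * s ^ 2) * hi ^ 2 / 2 + ((-2 : ℝ) * s) * hi ^ 3 / 3 + ((1 : ℝ)) * hi ^ 4 / 4) -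
      (((1 : ℝ) * s ^ 2) * lo ^ 2 / 2 + ((-2 : ℝ) * s) * lo ^ 3 / 3 + ((1 : ℝ)) * lo ^ 4 / 4) := by
  have hderiv : ∀ t : ℝ, HasDerivAt (fun t : ℝ => ((1 : ℝ) * s ^ 2) * t ^ 2 / 2 + ((-2 : ℝ) * s) * t ^ 3 / 3 + ((1 : ℝ)) * t ^ 4 / 4)
      (t ^ 1 * (s - t) ^ 2) t := by
    intro t
    have h0 := ((hasDerivAt_pow 2 t).const_mul ((1 : ℝ) * s ^ 2)).div_const (2 : ℝ)
    have h1 := ((hasDerivAt_pow 3 t).const_mul ((-2 : ℝ) * s)).div_const (3 : ℝ)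
    have h2 := ((hasDerivAt_pow 4 t).const_mul ((1 : ℝ))).div_const (4 : ℝ)
    refine ((((h0.add h1).add h2).congr_of_eventuallyEq ?_).congr_deriv ?_)
    · exact Filter.Eventually.of_forall fun y => by simp only [Pi.add_apply]
    · push_cast; try ring
  rw [intervalIntegral.integral_eq_sub_of_hasDerivAt (fun t _ => hderiv t)
    ((by fun_prop : Continuous fun t : ℝ => t ^ 1 * (s - t) ^ 2).intervalIntegrable _ _)]

/-- `N_{12}(r)` (raw integrand) for `0 < r ≤ 1`. [folklore] -/
theorem innerMomentRaw_low_1_2_0164 {r : ℝ} (hr0 : 0 < r) (hr1 : r ≤ 1) :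
    (∫ x in Set.Ioo 0 r, (if (0 < x ∧ x < 1) ∧ (0 < r - x ∧ r - x < 1) then x ^ 1 * (r - x) ^ 2 else 0)) =
      (1 / 12 : ℝ) * r ^ 4 := by
  rw [inner_window_low_0164 hr0 hr1 (fun x : ℝ => x ^ 1 * (r - x) ^ 2), rawInt_1_2_0164 r 0 r]
  ring

/-- `N_{12}(r)` (raw integrand) for `1 ≤ r ≤ 2`. [folklore] -/
theorem innerMomentRaw_high_1_2_0164 {r : ℝ} (hr1 : 1 ≤ r) (hr2 : r ≤ 2) :
    (∫ x in Set.Ioo 0 r, (if (0 < x ∧ x < 1) ∧ (0 < r - x ∧ r - x < 1) then x ^ 1 * (r - x) ^ 2 else 0)) =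
      (-(1 / 3) : ℝ) * r + (1 / 2 : ℝ) * r ^ 2 + (-(1 / 12) : ℝ) * r ^ 4 := by
  rw [inner_window_high_0164 hr1 hr2 (fun x : ℝ => x ^ 1 * (r - x) ^ 2), rawInt_1_2_0164 r (r - 1) 1]
  ring

/-- Polynomial antiderivative (generated): `∫ t^2·P(s−t)` for `P = (1 : ℝ)`. [folklore] -/
theorem rawInt_2_0_0164 (s lo hi : ℝ) :
    (∫ t in lo..hi, t ^ 2 * (s - t) ^ 0) =
      (((1 : ℝ)) * hi ^ 3 / 3) -
      (((1 : ℝ)) * lo ^ 3 / 3) := by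
  have hderiv : ∀ t : ℝ, HasDerivAt (fun t : ℝ => ((1 : ℝ)) * t ^ 3 / 3)
      (t ^ 2 * (s - t) ^ 0) t := by
    intro t
    have h0 := ((hasDerivAt_pow 3 t).const_mul ((1 : ℝ))).div_const (3 : ℝ)
    refine ((h0.congr_of_eventuallyEq ?_).congr_deriv ?_)
    · exact Filter.Eventually.of_forall fun y => rfl
    · push_cast; try ring
  rw [intervalIntegral.integral_eq_sub_of_hasDerivAt (fun t _ => hderiv t)
    ((by fun_prop : Continuous fun t : ℝ => t ^ 2 * (s - t) ^ 0).intervalIntegrable _ _)]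

/-- `N_{20}(r)` (raw integrand) for `0 < r ≤ 1`. [folklore] -/
theorem innerMomentRaw_low_2_0_0164 {r : ℝ} (hr0 : 0 < r) (hr1 : r ≤ 1) :
    (∫ x in Set.Ioo 0 r, (if (0 < x ∧ x < 1) ∧ (0 < r - x ∧ r - x < 1) then x ^ 2 * (r - x) ^ 0 else 0)) =
      (1 / 3 : ℝ) * r ^ 3 := by
  rw [inner_window_low_0164 hr0 hr1 (fun x : ℝ => x ^ 2 * (r - x) ^ 0), rawInt_2_0_0164 r 0 r]
  ring

/-- `N_{20}(r)` (raw integrand) for `1 ≤ r ≤ 2`. [folklore] -/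
theorem innerMomentRaw_high_2_0_0164 {r : ℝ} (hr1 : 1 ≤ r) (hr2 : r ≤ 2) :
    (∫ x in Set.Ioo 0 r, (if (0 < x ∧ x < 1) ∧ (0 < r - x ∧ r - x < 1) then x ^ 2 * (r - x) ^ 0 else 0)) =
      (2 / 3 : ℝ) + (-1 : ℝ) * r + (1 : ℝ) * r ^ 2 + (-(1 / 3) : ℝ) * r ^ 3 := by
  rw [inner_window_high_0164 hr1 hr2 (fun x : ℝ => x ^ 2 * (r - x) ^ 0), rawInt_2_0_0164 r (r - 1) 1]
  ring

/-- Polynomial antiderivative (generated): `∫ t^2·P(s−t)` for `P = (1 : ℝ) * r`. [folklore] -/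
theorem rawInt_2_1_0164 (s lo hi : ℝ) :
    (∫ t in lo..hi, t ^ 2 * (s - t) ^ 1) =
      (((1 : ℝ) * s) * hi ^ 3 / 3 + ((-1 : ℝ)) * hi ^ 4 / 4) -
      (((1 : ℝ) * s) * lo ^ 3 / 3 + ((-1 : ℝ)) * lo ^ 4 / 4) := by
  have hderiv : ∀ t : ℝ, HasDerivAt (fun t : ℝ => ((1 : ℝ) * s) * t ^ 3 / 3 + ((-1 : ℝ)) * t ^ 4 / 4)
      (t ^ 2 * (s - t) ^ 1) t := by
    intro t
    have h0 := ((hasDerivAt_pow 3 t).const_mul ((1 : ℝ) * s)).div_const (3 : ℝ)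
    have h1 := ((hasDerivAt_pow 4 t).const_mul ((-1 : ℝ))).div_const (4 : ℝ)
    refine (((h0.add h1).congr_of_eventuallyEq ?_).congr_deriv ?_)
    · exact Filter.Eventually.of_forall fun y => by simp only [Pi.add_apply]
    · push_cast; try ring
  rw [intervalIntegral.integral_eq_sub_of_hasDerivAt (fun t _ => hderiv t)
    ((by fun_prop : Continuous fun t : ℝ => t ^ 2 * (s - t) ^ 1).intervalIntegrable _ _)]

/-- `N_{21}(r)` (raw integrand) for `0 < r ≤ 1`. [folklore] -/
theorem innerMomentRaw_low_2_1_0164 {r : ℝ} (hr0 : 0 < r) (hr1 : r ≤ 1) :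
    (∫ x in Set.Ioo 0 r, (if (0 < x ∧ x < 1) ∧ (0 < r - x ∧ r - x < 1) then x ^ 2 * (r - x) ^ 1 else 0)) =
      (1 / 12 : ℝ) * r ^ 4 := by
  rw [inner_window_low_0164 hr0 hr1 (fun x : ℝ => x ^ 2 * (r - x) ^ 1), rawInt_2_1_0164 r 0 r]
  ring

/-- `N_{21}(r)` (raw integrand) for `1 ≤ r ≤ 2`. [folklore] -/
theorem innerMomentRaw_high_2_1_0164 {r : ℝ} (hr1 : 1 ≤ r) (hr2 : r ≤ 2) :
    (∫ x in Set.Ioo 0 r, (if (0 < x ∧ x < 1) ∧ (0 < r - x ∧ r - x < 1) then x ^ 2 * (r - x) ^ 1 else 0)) =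
      (-(1 / 3) : ℝ) * r + (1 / 2 : ℝ) * r ^ 2 + (-(1 / 12) : ℝ) * r ^ 4 := by
  rw [inner_window_high_0164 hr1 hr2 (fun x : ℝ => x ^ 2 * (r - x) ^ 1), rawInt_2_1_0164 r (r - 1) 1]
  ring
end Summit.Parity.GeneralizedHardyLittlewood.FordMaynardNoSieveConst0164NegWitness0164

end
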